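import Mathlib

/-!
# TwoAdicLadder — crux `TwoIntegralNormalisation` (stmt-ValiantsHypothesis-5947), line `birth`,
# stub `stub_halfElim`: a model in which division by `2` IS essential (sums of powers of linear forms)

Census data point for the open kernel `DivElim` ("exact division of a `2`-adically integral circuit
by a power of `2` at polynomial cost", `…DivisionForm.lean`). The crux's why-might-fail clause is
"`per` may be easy over `ℂ` only through division by `2`". In the general circuit model nobody can
exhibit such a phenomenon (it would be a lower bound over `ℤ_(2)`); in the model of SUMS OF POWERS
OF LINEAR FORMS (`ΣΛΣ`, Waring decompositions) it occurs in its sharpest possible form, by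
polarisation:

* `two_mul_X_mul_X_eq_sum_sq` — `2·x₀x₁ = (x₀ + x₁)² − x₀² − x₁²` over every commutative ring: the
  scaled monomial is a signed sum of three squares of linear forms with coefficients `0, ±1`;
* `isUnit_two_of_X_mul_X_eq_sum_smul_sq` — conversely, if `x₀x₁ = Σᵢ cᵢ (aᵢx₀ + bᵢx₁)²` over a
  commutative ring `R` then `2` is a unit of `R` (compare the coefficients of `x₀x₁`:
  `1 = 2 Σᵢ cᵢaᵢbᵢ`); so over `ℤ_(2)`, over every `𝓞_(𝔭)` with `𝔭 ∋ 2`, and over every admissible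
  finite ring of the route, `x₀x₁` has NO Waring decomposition at all, while `2·x₀x₁` has one of
  size `3`: in the `ΣΛΣ` model "`L(2f) < ∞ = L(f)`".

The same coefficient comparison shows that `x₁⋯x_n` (a projection of `per_n`) has no decomposition
`Σ cᵢ ℓᵢⁿ` over a ring in which `n!` is not a unit, while `2^{n-1} n! · x₁⋯x_n` has Fischer's
decomposition of size `2^{n-1}` — the polarisation constant is exactly the kind of power of `2`
that Glynn's formula and Valiant's completeness proof divide by. Honest framing: a two-variable toy
model; it says nothing about general circuits, where `DivElim` is open, and nothing about VP ≠ VNP.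
-/

noncomputable section

open MvPolynomial

-- the summit and the problem share the name `ValiantsHypothesis` (D-0017 single-conjunct layout)
set_option linter.dupNamespace false

namespace Summit.ValiantsHypothesis.ValiantsHypothesis.Theorems.TwoAdicLadder.TwoIntegralNormalisation

variable {R : Type*} [CommRing R]

/-- **Polarisation: `2·x₀x₁` is a signed sum of three squares of linear forms** over every
commutative ring: `2 x₀ x₁ = (x₀ + x₁)² − x₀² − x₁²`. [folklore] -/
theorem two_mul_X_mul_X_eq_sum_sq :
    (C 2 * (X 0 * X 1) : MvPolynomial (Fin 2) R) =
      (X 0 + X 1) ^ 2 - X 0 ^ 2 - X 1 ^ 2 := by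
  rw [map_ofNat]
  ring

/-- The coefficient of `x₀x₁` in the square of a linear form `a x₀ + b x₁` is `2ab`. [folklore] -/
theorem coeff_sq_linear (a b : R) :
    coeff (Finsupp.single 0 1 + Finsupp.single 1 1)
        ((C a * X 0 + C b * X 1) ^ 2 : MvPolynomial (Fin 2) R) = 2 * (a * b) := by
  have hexp : (C a * X 0 + C b * X 1 : MvPolynomial (Fin 2) R) ^ 2 =
      C (a * a) * (X 0 * X 0) + C (2 * (a * b)) * (X 0 * X 1) + C (b * b) * (X 1 * X 1) := by
    simp only [map_mul, map_ofNat]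
    ring
  have h01 : (X 0 * X 1 : MvPolynomial (Fin 2) R) =
      monomial (Finsupp.single 0 1 + Finsupp.single 1 1) 1 := by
    rw [X, X, monomial_mul, one_mul]
  have h00 : (X 0 * X 0 : MvPolynomial (Fin 2) R) = monomial (Finsupp.single 0 2) 1 := by
    rw [X, monomial_mul, one_mul, ← Finsupp.single_add]
  have h11 : (X 1 * X 1 : MvPolynomial (Fin 2) R) = monomial (Finsupp.single 1 2) 1 := by
    rw [X, monomial_mul, one_mul, ← Finsupp.single_add]
  have hne0 : (Finsupp.single 0 2 : Fin 2 →₀ ℕ) ≠ Finsupp.single 0 1 + Finsupp.single 1 1 := by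
    intro h
    have := Finsupp.ext_iff.1 h 1
    simp at this
  have hne1 : (Finsupp.single 1 2 : Fin 2 →₀ ℕ) ≠ Finsupp.single 0 1 + Finsupp.single 1 1 := by
    intro h
    have := Finsupp.ext_iff.1 h 0
    simp at this
  rw [hexp, h01, h00, h11, coeff_add, coeff_add, coeff_C_mul, coeff_C_mul, coeff_C_mul,
    coeff_monomial, coeff_monomial, coeff_monomial, if_neg hne0, if_pos rfl, if_neg hne1]
  ring

/-- **If `x₀x₁` is a linear combination of squares of linear forms, then `2` is a unit.** For a
commutative ring `R`, a finite index set and coefficients `cᵢ, aᵢ, bᵢ ∈ R` with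
`x₀ x₁ = Σᵢ cᵢ (aᵢ x₀ + bᵢ x₁)²` in `R[x₀, x₁]`, comparing the coefficients of `x₀x₁` gives
`1 = 2 Σᵢ cᵢ aᵢ bᵢ`. Contrapositive: over a ring in which `2` is not a unit (`ℤ_(2)`, `𝓞_(𝔭)` with
`𝔭 ∋ 2`, `ℤ/2^k`, …) the monomial `x₀x₁` has no Waring decomposition, although `2·x₀x₁` has one of
size three (`two_mul_X_mul_X_eq_sum_sq`): in the sums-of-powers model division by `2` is
essential. [folklore] -/
theorem isUnit_two_of_X_mul_X_eq_sum_smul_sq {ι : Type*} (s : Finset ι) (c a b : ι → R)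
    (h : (X 0 * X 1 : MvPolynomial (Fin 2) R) = ∑ i ∈ s, C (c i) * (C (a i) * X 0 + C (b i) * X 1) ^ 2) :
    IsUnit (2 : R) := by
  have hc := congrArg (coeff (Finsupp.single 0 1 + Finsupp.single 1 1)) h
  have h01 : (X 0 * X 1 : MvPolynomial (Fin 2) R) =
      monomial (Finsupp.single 0 1 + Finsupp.single 1 1) 1 := by
    rw [X, X, monomial_mul, one_mul]
  rw [h01, coeff_monomial, if_pos rfl, coeff_sum] at hc
  simp only [coeff_C_mul, coeff_sq_linear] at hc
  have key : (1 : R) = 2 * ∑ i ∈ s, c i * (a i * b i) := by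
    rw [hc, Finset.mul_sum]
    refine Finset.sum_congr rfl fun i _ => ?_
    ring
  exact IsUnit.of_mul_eq_one _ key.symm

/-- The `2`-local instance: over the localisation of the ring of integers of a number field at a
prime `𝔭 ∋ 2` (the target rings of `stub_halfElim`), `x₀x₁` is not a linear combination of squares
of linear forms. [folklore] -/
theorem X_mul_X_ne_sum_smul_sq_localizationAtPrime (K : Type) [Field K] [NumberField K]
    (P : Ideal (NumberField.RingOfIntegers K)) [P.IsPrime]
    (h2 : (2 : NumberField.RingOfIntegers K) ∈ P) {ι : Type*} (s : Finset ι)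
    (c a b : ι → Localization.AtPrime P) :
    (X 0 * X 1 : MvPolynomial (Fin 2) (Localization.AtPrime P)) ≠
      ∑ i ∈ s, C (c i) * (C (a i) * X 0 + C (b i) * X 1) ^ 2 := by
  intro h
  have hu := isUnit_two_of_X_mul_X_eq_sum_smul_sq s c a b h
  -- `2` lies in the maximal ideal of the local ring `𝓞_(𝔭)`
  have hmem : (2 : Localization.AtPrime P) ∈ IsLocalRing.maximalIdeal (Localization.AtPrime P) := by
    have : (algebraMap (NumberField.RingOfIntegers K) (Localization.AtPrime P)) 2 ∈
        IsLocalRing.maximalIdeal (Localization.AtPrime P) := by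
      rw [← Localization.AtPrime.map_eq_maximalIdeal]
      exact Ideal.mem_map_of_mem _ h2
    rwa [map_ofNat] at this
  exact (IsLocalRing.maximalIdeal.isMaximal _).ne_top
    (Ideal.eq_top_of_isUnit_mem _ hmem hu)

end Summit.ValiantsHypothesis.ValiantsHypothesis.Theorems.TwoAdicLadder.TwoIntegralNormalisation

end
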